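import Summits.BirchSwinnertonDyer.BirchSwinnertonDyer.Theses.UniversalToricDescent
import HarnessLib

/-!
# Route `UniversalToricDescent`: the SHARPENED research stub K1♯ of line `membertower` v14 on ♭B′
# `TwinWanFrameAtThreeMultTresT` (stmt-BirchSwinnertonDyer-27401) — its quantifier `∀ m ≥ 1` is idle beyond
# `m = 1`: K1♯ is EQUIVALENT to its depth-ONE slice; and K1-at-3 (stmt-BirchSwinnertonDyer-27934) ⟹ K1♯

Width seat bsd-wall-utd-p2-w2 g8, `--supports stmt-BirchSwinnertonDyer-27934` (helper). Statement hygiene for the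
sharpened stub, kernel-checked; theorems only (no definition, no named fact, no `sorry`).

CONTEXT. The lead's skeleton v14 (sha `8ce0a415332e`, registered 2026-08-28T16:23Z on 27401 and on ♭B′° 22539)
replaces the research stub K1 = `TwinMemberRationalInclusionAtThree` (child 27934, verbatim `∀ (m : ℕ) (D : HidaCongruentMember W′ 3 m)`)
by the vet's sharpening K1♯ (refuter bsd-vet-utdR2 g0): the same text with the two extra binders `1 ≤ m →` and
`SkinnerUrban2014.IsResiduallyIrreducible D.Δ →` — the line consumes K1 only at the members delivered by the
Castella fact (depth `m ≥ 1`, `ρ̄_{g_m} ≅ W′[3]` irreducible); glue = p645093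
`…AllSplit.twinWanFrameAtThreeMultTresT_of_thmB_of_nonsplitMembersFrames_of_irredMemberRationalInclusion`.

WHAT IS PROVED (the analogue, for K1♯, of the depth-`0` certificate p638021 `…_iff_depthZero` for K1):
* `exists_torsionBy_equivariant_equiv_of_dvd` (generic: any continuous `𝒪`-linear `ρ`, `ρ′`, `r ∣ s`) and its instance
  `exists_equivariant_equiv_of_le` — a Hida congruent member at depth `m` RESTRICTS to every depth `n ≤ m`: the
  equivariant `𝒪`-isomorphism `A_g[p^m] ≃ (W[p^∞] ⊗ 𝒪)[p^m]` (Skinner 2016 §3.1 (b)) restricts to the `p^n`-torsion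
  (`p^n ∣ p^m`), equivariantly. Elementary (`Submodule.torsionBy_le_torsionBy_of_dvd`, `LinearMap.codRestrict`).
* `sharp_of_sharpDepthOne` / `sharpDepthOne_of_sharp` / `sharp_iff_sharpDepthOne` — **K1♯ ⟺ K1♯ at depth EXACTLY `1`**
  (`∀ (D : HidaCongruentMember W′ 3 1), IsResiduallyIrreducible D.Δ → …`): the conclusion of K1♯ sees only
  `(D.g, D.ι, D.Δ)`, and a depth-`m` member (`1 ≤ m`) read at depth `1` (same `g, ι, Δ`; bound `(3^m)⁻¹ ≤ 3⁻¹`;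
  congruence iso restricted to the `3`-torsion) is a depth-`1` member.
* `sharp_of_twinMemberRationalInclusionAtThree` — K1 (27934 BY NAME) ⟹ K1♯ (discard the two binders).
GLUE RECIPE (not declared here, to keep this file on the light import `Theses.UniversalToricDescent` at default heartbeats):
♭B′ 27401 BY NAME from {Hsieh Thm B (20711), `…_odd_nonsplit` (22593), K1♯ depth-one `h1`} is
`…AllSplit.twinWanFrameAtThreeMultTresT_of_thmB_of_nonsplitMembersFrames_of_irredMemberRationalInclusion hB hC′ (sharp_of_sharpDepthOne h1)`
(p645093) — the turnkey should the pen re-type 27934 as the depth-one text.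

READING (numbers, not adjectives). K1♯ = «for every `3`-ordinary newform `g ∈ S_k(Γ₀(N′/3))`, `k > 2` even, with a
`3`-adic embedding `ι`, an integral ordinary datum `Δ` whose reduction `ρ̄_g` is IRREDUCIBLE, congruent to the twin
MOD 3 (`a_ℓ(g) ≡ a_ℓ(W′) (mod 3)` at the good primes and `A_g[3] ≃ (W′[3^∞] ⊗ 𝒪)[3]` equivariantly): at every
Σ-frame `Q` of `g` (periods `Ω_K ≠ 0`, `Ω_p ∈ 𝓞_{ℂ₃}ˣ`), `X^Σ_ac(A_g; 𝔭′)` torsion ⇒ `∃ e, (C 3)^e · Ch · 𝓞_{ℂ₃}⟦T⟧ ⊆ (Q)`».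
The deeper congruences `mod 3^m`, `m ≥ 2`, asked by the text are idle. Items closed 0; classes closed 0; BSD is
proved for no curve by this file.
-/

noncomputable section

open scoped Classical

set_option linter.dupNamespace false
set_option autoImplicit false

namespace Summit.BirchSwinnertonDyer.BirchSwinnertonDyer.Theorems.UniversalToricDescentTwinMemberRationalInclusionAtThreeSharp

open PowerSeries WeierstrassCurve NumberField IsDedekindDomain Field
  Literature.NumberTheory.EllipticCurves
  Literature.NumberTheory.EllipticCurves.ModularForms
  Literature.NumberTheory.EllipticCurves.Rank1Residual
  Literature.NumberTheory.EllipticCurves.BigGaloisRep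
  Literature.NumberTheory.EllipticCurves.GreenbergSelmer
  Literature.NumberTheory.GaloisRepresentations
  Summit.BirchSwinnertonDyer.Rank1Residual.X11b
  Summit.BirchSwinnertonDyer.Rank1Residual.X11b.Halves
  Summit.BirchSwinnertonDyer.BirchSwinnertonDyer.Theorems.SchneiderFree
  Summit.BirchSwinnertonDyer.BirchSwinnertonDyer.Theses.UniversalToricDescent

/-! ## §1 A member at depth `m` restricts to every depth `n ≤ m` -/

section Generic

universe u

variable {𝒪 : Type*} [CommRing 𝒪] [TopologicalSpace 𝒪]
  {A A' : Type u} [AddCommGroup A] [Module 𝒪 A] [TopologicalSpace A]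
  [AddCommGroup A'] [Module 𝒪 A'] [TopologicalSpace A']
  {G : Type u} [Group G] [TopologicalSpace G]

/-- **An equivariant isomorphism of `s`-torsion subrepresentations restricts to the `r`-torsion for `r ∣ s`.**
For continuous `𝒪`-linear representations `ρ` on `A` and `ρ'` on `A'`, an `𝒪`-linear `e : A[s] ≃ A'[s]` intertwining
`torsionRep ρ s` and `ρ'` restricts (as `A[r] ⊆ A[s]`, `A'[r] ⊆ A'[s]`) to an `𝒪`-linear `A[r] ≃ A'[r]` intertwining
`torsionRep ρ r` and `ρ'`. Elementary. [cite: Skinner2016PacificMC, §3.1 (b) (p. 192) ("`T_f/p^m T_f ≅ T_{f_m}/p^m T_{f_m}` as `𝒪[G_ℚ]`-modules")] -/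
theorem exists_torsionBy_equivariant_equiv_of_dvd (ρ : ContinuousRep G 𝒪 A) (ρ' : ContinuousRep G 𝒪 A')
    {r s : 𝒪} (hrs : r ∣ s) (e : Submodule.torsionBy 𝒪 A s ≃ₗ[𝒪] Submodule.torsionBy 𝒪 A' s)
    (he : ∀ (g : G) (a : Submodule.torsionBy 𝒪 A s), (e (torsionRep ρ s g a) : A') = ρ' g (e a : A')) :
    ∃ e' : Submodule.torsionBy 𝒪 A r ≃ₗ[𝒪] Submodule.torsionBy 𝒪 A' r,
      ∀ (g : G) (a : Submodule.torsionBy 𝒪 A r), (e' (torsionRep ρ r g a) : A') = ρ' g (e' a : A') := by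
  have hA : Submodule.torsionBy 𝒪 A r ≤ Submodule.torsionBy 𝒪 A s :=
    Submodule.torsionBy_le_torsionBy_of_dvd _ _ hrs
  have hB : Submodule.torsionBy 𝒪 A' r ≤ Submodule.torsionBy 𝒪 A' s :=
    Submodule.torsionBy_le_torsionBy_of_dvd _ _ hrs
  -- `e` maps the `r`-torsion into the `r`-torsion, and so does `e⁻¹`
  have hf : ∀ a : Submodule.torsionBy 𝒪 A r,
      ((Submodule.torsionBy 𝒪 A' s).subtype ∘ₗ e.toLinearMap ∘ₗ Submodule.inclusion hA) a ∈
        Submodule.torsionBy 𝒪 A' r := by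
    intro a
    have ha : r • Submodule.inclusion hA a = 0 :=
      Subtype.ext (by
        rw [Submodule.coe_smul, Submodule.coe_inclusion, Submodule.coe_zero]
        exact (Submodule.mem_torsionBy_iff _ _).1 a.2)
    rw [Submodule.mem_torsionBy_iff]
    simp only [LinearMap.coe_comp, Function.comp_apply, Submodule.coe_subtype, LinearEquiv.coe_coe]
    rw [← Submodule.coe_smul, ← map_smul, ha, map_zero, Submodule.coe_zero]
  have hg : ∀ b : Submodule.torsionBy 𝒪 A' r,
      ((Submodule.torsionBy 𝒪 A s).subtype ∘ₗ e.symm.toLinearMap ∘ₗ Submodule.inclusion hB) b ∈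
        Submodule.torsionBy 𝒪 A r := by
    intro b
    have hb : r • Submodule.inclusion hB b = 0 :=
      Subtype.ext (by
        rw [Submodule.coe_smul, Submodule.coe_inclusion, Submodule.coe_zero]
        exact (Submodule.mem_torsionBy_iff _ _).1 b.2)
    rw [Submodule.mem_torsionBy_iff]
    simp only [LinearMap.coe_comp, Function.comp_apply, Submodule.coe_subtype, LinearEquiv.coe_coe]
    rw [← Submodule.coe_smul, ← map_smul, hb, map_zero, Submodule.coe_zero]
  -- the two restrictions, read in the `s`-torsion, are `e` and `e⁻¹`
  have hf_incl : ∀ a, Submodule.inclusion hB (LinearMap.codRestrict _ _ hf a) = e (Submodule.inclusion hA a) :=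
    fun a => Subtype.ext rfl
  have hg_incl : ∀ b, Submodule.inclusion hA (LinearMap.codRestrict _ _ hg b) = e.symm (Submodule.inclusion hB b) :=
    fun b => Subtype.ext rfl
  have hfg : LinearMap.codRestrict _ _ hf ∘ₗ LinearMap.codRestrict _ _ hg = LinearMap.id := by
    apply LinearMap.ext
    intro b
    apply Submodule.inclusion_injective hB
    rw [LinearMap.comp_apply, hf_incl, hg_incl, LinearEquiv.apply_symm_apply, LinearMap.id_apply]
  have hgf : LinearMap.codRestrict _ _ hg ∘ₗ LinearMap.codRestrict _ _ hf = LinearMap.id := by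
    apply LinearMap.ext
    intro a
    apply Submodule.inclusion_injective hA
    rw [LinearMap.comp_apply, hg_incl, hf_incl, LinearEquiv.symm_apply_apply, LinearMap.id_apply]
  refine ⟨LinearEquiv.ofLinear _ _ hfg hgf, fun g a => ?_⟩
  -- equivariance, inherited from `he` through the inclusion `A[r] ⊆ A[s]`
  have hincl : Submodule.inclusion hA (torsionRep ρ r g a) = torsionRep ρ s g (Submodule.inclusion hA a) :=
    Subtype.ext rfl
  have key := he g (Submodule.inclusion hA a)
  rw [← hincl, ← hf_incl, ← hf_incl, Submodule.coe_inclusion, Submodule.coe_inclusion] at key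
  exact key

end Generic

section Restrict

variable {W : WeierstrassCurve ℚ} [W.IsGloballyMinimal] {p : ℕ} [Fact p.Prime] {m n : ℕ}

/-- **Restriction of the congruence (b) of a Hida congruent member to a smaller depth.** For
`D : HidaCongruentMember W p m` and `n ≤ m`, the equivariant isomorphism `D.e : A_g[p^m] ≃ₗ[𝒪] (W[p^∞] ⊗ 𝒪)[p^m]`
restricts to an `𝒪`-linear isomorphism `A_g[p^n] ≃ₗ[𝒪] (W[p^∞] ⊗ 𝒪)[p^n]` (the `p^n`-torsion inside the `p^m`-torsion,
`p^n ∣ p^m`), again `G_ℚ`-equivariant — i.e. the field `exists_equivariant_equiv` at depth `n` for the same `(g, ι, Δ)`.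
[cite: Skinner2016PacificMC, §3.1 (b) (p. 192) ("`T_f/p^m T_f ≅ T_{f_m}/p^m T_{f_m}` as `𝒪[G_ℚ]`-modules")] -/
theorem exists_equivariant_equiv_of_le (D : Skinner2016.HidaCongruentMember W p m) (hnm : n ≤ m) :
    ∃ e : Skinner2016.MemberTorsion D.Δ n ≃ₗ[padicCoeffIntegers D.ι]
        Skinner2016.CurveCoeffTorsion (p := p) W D.ι n,
      ∀ (σ : absoluteGaloisGroup ℚ) (a : Skinner2016.MemberTorsion D.Δ n),
        (e (torsionRep D.Δ.cofreeRep (((p : ℕ) : padicCoeffIntegers D.ι) ^ n) σ a) :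
            Skinner2016.CurveCoeffModule (p := p) W D.ι) =
          Skinner2016.curveCoeffRep W D.ι σ (e a : Skinner2016.CurveCoeffModule (p := p) W D.ι) :=
  exists_torsionBy_equivariant_equiv_of_dvd D.Δ.cofreeRep (Skinner2016.curveCoeffRep W D.ι)
    (pow_dvd_pow _ hnm) D.e D.he

end Restrict


/-! ## §2 K1♯ ⟺ its depth-one slice; K1 ⟹ K1♯ -/

section Sharp

set_option maxHeartbeats 400000 in
/-- **K1♯ ⟹ its depth-`1` slice** (instantiate `m := 1`). The hypothesis is the registered stub
`stub_memberRationalInclusionAtThree` of `membertower` v14 VERBATIM (K1♯); the conclusion is its text with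
`∀ (m : ℕ), 1 ≤ m → ∀ (D : HidaCongruentMember W′ 3 m)` replaced by `∀ (D : HidaCongruentMember W′ 3 1)`. -/
theorem sharpDepthOne_of_sharp
    (h :
    ∀ (W' : WeierstrassCurve ℚ) [W'.IsElliptic] [W'.IsGloballyMinimal] (N' : ℕ) [NeZero N']
      (K : Type) [Field K] [NumberField K] (Dt' : ModularParametrizationData W' N'),
      Mult W' 3 → W'.HasSurjectiveModNGaloisRep 3 → W'.conductorNorm ℤ = N' → IsImaginaryQuadratic K →
      SatisfiesHeegnerHypothesis N' K → Odd (NumberField.discr K) →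
      ∀ (κ : ZpExtension K 3), κ.IsAnticyclotomic → ∀ (γ : absoluteGaloisGroup K) [Fact (κ.IsTopGenerator γ)]
        (𝔭 : HeightOneSpectrum (𝓞 K)), ((3 : ℕ) : 𝓞 K) ∈ 𝔭.asIdeal →
        𝔭.asIdeal.ramificationIdx (𝓞 ℚ) = 1 → 𝔭.asIdeal.inertiaDeg (𝓞 ℚ) = 1 →
        ∀ (𝔭' : HeightOneSpectrum (𝓞 K)), ((3 : ℕ) : 𝓞 K) ∈ 𝔭'.asIdeal → 𝔭' ≠ 𝔭 →
        ∀ (ι' : PadicAlgCl 3 ≃+* ℂ), BranchInducesPrime 3 ι' 𝔭 →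
        ∀ (m : ℕ), 1 ≤ m → ∀ (D : Skinner2016.HidaCongruentMember W' 3 m),
          SkinnerUrban2014.IsResiduallyIrreducible D.Δ → (∀ x : coeffField D.g, ι' (D.ι x) = (x : ℂ)) →
        ∀ (b : padicCoeffIntegers D.ι →+* 𝓞_ℂ_[3]),
          (∀ x, ((b x : 𝓞_ℂ_[3]) : ℂ_[3]) = algebraMap (PadicAlgCl 3) ℂ_[3] (padicCoeffIntegers.toPadicAlgCl D.ι x)) →
        ∀ (ΩK : ℂ) (Ωp : (𝓞_ℂ_[3])ˣ) (Q : PowerSeries 𝓞_ℂ_[3]), ΩK ≠ 0 →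
          IsBDPLFunctionWtSigmaInt ι' 𝔭 κ γ D.g (W'.sigmaPlacesFinset 3 K) ΩK ((Ωp : 𝓞_ℂ_[3]) : ℂ_[3]) Q →
        ∀ [TopologicalSpace (PowerSeries (padicCoeffIntegers D.ι))]
          [ContinuousSMul (PowerSeries (padicCoeffIntegers D.ι))
            (BigRepModule (padicCoeffIntegers D.ι) 3 (Cofree D.Δ.ρ (padicCoeffField D.ι)))],
          Module.IsTorsion (PowerSeries (padicCoeffIntegers D.ι))
              (XBig κ (D.Δ.cofreeRepOver K) 𝔭' (↑(W'.sigmaPlacesFinset 3 K))) →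
            ∃ e : ℕ, Ideal.span {(PowerSeries.C ((3 : ℕ) : 𝓞_ℂ_[3]) : PowerSeries 𝓞_ℂ_[3]) ^ e} *
                (XBig.charIdeal κ (D.Δ.cofreeRepOver K) 𝔭' (↑(W'.sigmaPlacesFinset 3 K))).map (PowerSeries.map b) ≤
              Ideal.span {Q}) :
    ∀ (W' : WeierstrassCurve ℚ) [W'.IsElliptic] [W'.IsGloballyMinimal] (N' : ℕ) [NeZero N']
      (K : Type) [Field K] [NumberField K] (Dt' : ModularParametrizationData W' N'),
      Mult W' 3 → W'.HasSurjectiveModNGaloisRep 3 → W'.conductorNorm ℤ = N' → IsImaginaryQuadratic K →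
      SatisfiesHeegnerHypothesis N' K → Odd (NumberField.discr K) →
      ∀ (κ : ZpExtension K 3), κ.IsAnticyclotomic → ∀ (γ : absoluteGaloisGroup K) [Fact (κ.IsTopGenerator γ)]
        (𝔭 : HeightOneSpectrum (𝓞 K)), ((3 : ℕ) : 𝓞 K) ∈ 𝔭.asIdeal →
        𝔭.asIdeal.ramificationIdx (𝓞 ℚ) = 1 → 𝔭.asIdeal.inertiaDeg (𝓞 ℚ) = 1 →
        ∀ (𝔭' : HeightOneSpectrum (𝓞 K)), ((3 : ℕ) : 𝓞 K) ∈ 𝔭'.asIdeal → 𝔭' ≠ 𝔭 →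
        ∀ (ι' : PadicAlgCl 3 ≃+* ℂ), BranchInducesPrime 3 ι' 𝔭 →
        ∀ (D : Skinner2016.HidaCongruentMember W' 3 1),
          SkinnerUrban2014.IsResiduallyIrreducible D.Δ → (∀ x : coeffField D.g, ι' (D.ι x) = (x : ℂ)) →
        ∀ (b : padicCoeffIntegers D.ι →+* 𝓞_ℂ_[3]),
          (∀ x, ((b x : 𝓞_ℂ_[3]) : ℂ_[3]) = algebraMap (PadicAlgCl 3) ℂ_[3] (padicCoeffIntegers.toPadicAlgCl D.ι x)) →
        ∀ (ΩK : ℂ) (Ωp : (𝓞_ℂ_[3])ˣ) (Q : PowerSeries 𝓞_ℂ_[3]), ΩK ≠ 0 →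
          IsBDPLFunctionWtSigmaInt ι' 𝔭 κ γ D.g (W'.sigmaPlacesFinset 3 K) ΩK ((Ωp : 𝓞_ℂ_[3]) : ℂ_[3]) Q →
        ∀ [TopologicalSpace (PowerSeries (padicCoeffIntegers D.ι))]
          [ContinuousSMul (PowerSeries (padicCoeffIntegers D.ι))
            (BigRepModule (padicCoeffIntegers D.ι) 3 (Cofree D.Δ.ρ (padicCoeffField D.ι)))],
          Module.IsTorsion (PowerSeries (padicCoeffIntegers D.ι))
              (XBig κ (D.Δ.cofreeRepOver K) 𝔭' (↑(W'.sigmaPlacesFinset 3 K))) →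
            ∃ e : ℕ, Ideal.span {(PowerSeries.C ((3 : ℕ) : 𝓞_ℂ_[3]) : PowerSeries 𝓞_ℂ_[3]) ^ e} *
                (XBig.charIdeal κ (D.Δ.cofreeRepOver K) 𝔭' (↑(W'.sigmaPlacesFinset 3 K))).map (PowerSeries.map b) ≤
              Ideal.span {Q} :=
  fun W' _ _ N' _ K _ _ Dt' hmult hsurj hN' hK hH hodd κ hκ γ _ 𝔭 h𝔭 he hf 𝔭' h𝔭' hne ι' hι' D ↦
    h W' N' K Dt' hmult hsurj hN' hK hH hodd κ hκ γ 𝔭 h𝔭 he hf 𝔭' h𝔭' hne ι' hι' 1 le_rfl D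

set_option maxHeartbeats 400000 in
/-- **The depth-`1` slice ⟹ K1♯**: a member `D` at depth `m ≥ 1` READ AT DEPTH `1` — same `(k, g, ι, Δ)`, congruence
bound `(3^m)⁻¹ ≤ 3⁻¹`, and the equivariant isomorphism `A_g[3^m] ≃ (W′[3^∞] ⊗ 𝒪)[3^m]` restricted to the `3`-torsion
(`exists_equivariant_equiv_of_le`) — is a member at depth `1` with the same `D.g`, `D.ι`, `D.Δ`, which is all the
conclusion (and the irreducibility binder) of K1♯ sees. [cite: Skinner2016PacificMC, §3.1 (a)(b) (p. 192)] -/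
theorem sharp_of_sharpDepthOne
    (h1 :
    ∀ (W' : WeierstrassCurve ℚ) [W'.IsElliptic] [W'.IsGloballyMinimal] (N' : ℕ) [NeZero N']
      (K : Type) [Field K] [NumberField K] (Dt' : ModularParametrizationData W' N'),
      Mult W' 3 → W'.HasSurjectiveModNGaloisRep 3 → W'.conductorNorm ℤ = N' → IsImaginaryQuadratic K →
      SatisfiesHeegnerHypothesis N' K → Odd (NumberField.discr K) →
      ∀ (κ : ZpExtension K 3), κ.IsAnticyclotomic → ∀ (γ : absoluteGaloisGroup K) [Fact (κ.IsTopGenerator γ)]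
        (𝔭 : HeightOneSpectrum (𝓞 K)), ((3 : ℕ) : 𝓞 K) ∈ 𝔭.asIdeal →
        𝔭.asIdeal.ramificationIdx (𝓞 ℚ) = 1 → 𝔭.asIdeal.inertiaDeg (𝓞 ℚ) = 1 →
        ∀ (𝔭' : HeightOneSpectrum (𝓞 K)), ((3 : ℕ) : 𝓞 K) ∈ 𝔭'.asIdeal → 𝔭' ≠ 𝔭 →
        ∀ (ι' : PadicAlgCl 3 ≃+* ℂ), BranchInducesPrime 3 ι' 𝔭 →
        ∀ (D : Skinner2016.HidaCongruentMember W' 3 1),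
          SkinnerUrban2014.IsResiduallyIrreducible D.Δ → (∀ x : coeffField D.g, ι' (D.ι x) = (x : ℂ)) →
        ∀ (b : padicCoeffIntegers D.ι →+* 𝓞_ℂ_[3]),
          (∀ x, ((b x : 𝓞_ℂ_[3]) : ℂ_[3]) = algebraMap (PadicAlgCl 3) ℂ_[3] (padicCoeffIntegers.toPadicAlgCl D.ι x)) →
        ∀ (ΩK : ℂ) (Ωp : (𝓞_ℂ_[3])ˣ) (Q : PowerSeries 𝓞_ℂ_[3]), ΩK ≠ 0 →
          IsBDPLFunctionWtSigmaInt ι' 𝔭 κ γ D.g (W'.sigmaPlacesFinset 3 K) ΩK ((Ωp : 𝓞_ℂ_[3]) : ℂ_[3]) Q →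
        ∀ [TopologicalSpace (PowerSeries (padicCoeffIntegers D.ι))]
          [ContinuousSMul (PowerSeries (padicCoeffIntegers D.ι))
            (BigRepModule (padicCoeffIntegers D.ι) 3 (Cofree D.Δ.ρ (padicCoeffField D.ι)))],
          Module.IsTorsion (PowerSeries (padicCoeffIntegers D.ι))
              (XBig κ (D.Δ.cofreeRepOver K) 𝔭' (↑(W'.sigmaPlacesFinset 3 K))) →
            ∃ e : ℕ, Ideal.span {(PowerSeries.C ((3 : ℕ) : 𝓞_ℂ_[3]) : PowerSeries 𝓞_ℂ_[3]) ^ e} *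
                (XBig.charIdeal κ (D.Δ.cofreeRepOver K) 𝔭' (↑(W'.sigmaPlacesFinset 3 K))).map (PowerSeries.map b) ≤
              Ideal.span {Q}) :
    ∀ (W' : WeierstrassCurve ℚ) [W'.IsElliptic] [W'.IsGloballyMinimal] (N' : ℕ) [NeZero N']
      (K : Type) [Field K] [NumberField K] (Dt' : ModularParametrizationData W' N'),
      Mult W' 3 → W'.HasSurjectiveModNGaloisRep 3 → W'.conductorNorm ℤ = N' → IsImaginaryQuadratic K →
      SatisfiesHeegnerHypothesis N' K → Odd (NumberField.discr K) →
      ∀ (κ : ZpExtension K 3), κ.IsAnticyclotomic → ∀ (γ : absoluteGaloisGroup K) [Fact (κ.IsTopGenerator γ)]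
        (𝔭 : HeightOneSpectrum (𝓞 K)), ((3 : ℕ) : 𝓞 K) ∈ 𝔭.asIdeal →
        𝔭.asIdeal.ramificationIdx (𝓞 ℚ) = 1 → 𝔭.asIdeal.inertiaDeg (𝓞 ℚ) = 1 →
        ∀ (𝔭' : HeightOneSpectrum (𝓞 K)), ((3 : ℕ) : 𝓞 K) ∈ 𝔭'.asIdeal → 𝔭' ≠ 𝔭 →
        ∀ (ι' : PadicAlgCl 3 ≃+* ℂ), BranchInducesPrime 3 ι' 𝔭 →
        ∀ (m : ℕ), 1 ≤ m → ∀ (D : Skinner2016.HidaCongruentMember W' 3 m),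
          SkinnerUrban2014.IsResiduallyIrreducible D.Δ → (∀ x : coeffField D.g, ι' (D.ι x) = (x : ℂ)) →
        ∀ (b : padicCoeffIntegers D.ι →+* 𝓞_ℂ_[3]),
          (∀ x, ((b x : 𝓞_ℂ_[3]) : ℂ_[3]) = algebraMap (PadicAlgCl 3) ℂ_[3] (padicCoeffIntegers.toPadicAlgCl D.ι x)) →
        ∀ (ΩK : ℂ) (Ωp : (𝓞_ℂ_[3])ˣ) (Q : PowerSeries 𝓞_ℂ_[3]), ΩK ≠ 0 →
          IsBDPLFunctionWtSigmaInt ι' 𝔭 κ γ D.g (W'.sigmaPlacesFinset 3 K) ΩK ((Ωp : 𝓞_ℂ_[3]) : ℂ_[3]) Q →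
        ∀ [TopologicalSpace (PowerSeries (padicCoeffIntegers D.ι))]
          [ContinuousSMul (PowerSeries (padicCoeffIntegers D.ι))
            (BigRepModule (padicCoeffIntegers D.ι) 3 (Cofree D.Δ.ρ (padicCoeffField D.ι)))],
          Module.IsTorsion (PowerSeries (padicCoeffIntegers D.ι))
              (XBig κ (D.Δ.cofreeRepOver K) 𝔭' (↑(W'.sigmaPlacesFinset 3 K))) →
            ∃ e : ℕ, Ideal.span {(PowerSeries.C ((3 : ℕ) : 𝓞_ℂ_[3]) : PowerSeries 𝓞_ℂ_[3]) ^ e} *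
                (XBig.charIdeal κ (D.Δ.cofreeRepOver K) 𝔭' (↑(W'.sigmaPlacesFinset 3 K))).map (PowerSeries.map b) ≤
              Ideal.span {Q} := by
  intro W' _ _ N' _ K _ _ Dt' hmult hsurj hN' hK hH hodd κ hκ γ _ 𝔭 h𝔭 he hf 𝔭' h𝔭' hne ι' hι' m hm D hirr hι b hb
    ΩK Ωp Q hΩK hQ _ _ hT
  -- the congruence bound at depth `m ≥ 1` implies the one at depth `1`
  have h31 : (((3 : ℕ) : ℝ) ^ m)⁻¹ ≤ (((3 : ℕ) : ℝ) ^ (1 : ℕ))⁻¹ :=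
    inv_anti₀ (by positivity) (pow_le_pow_right₀ (by norm_num) hm)
  -- the congruence (b) restricted to the `3`-torsion
  obtain ⟨e₁, he₁⟩ := exists_equivariant_equiv_of_le (n := 1) D hm
  -- the member read at depth `1` (same `g`, `ι`, `Δ`)
  let D₁ : Skinner2016.HidaCongruentMember W' 3 1 :=
    ⟨⟨D.k, D.two_lt_k, D.dvd_k_sub_two, D.g, D.isNewform, D.ι, D.norm_coeff_p,
      fun ℓ hℓ hN => (D.norm_coeff_sub_le ℓ hℓ hN).trans h31, D.Δ⟩, ⟨e₁, he₁⟩⟩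
  exact h1 W' N' K Dt' hmult hsurj hN' hK hH hodd κ hκ γ 𝔭 h𝔭 he hf 𝔭' h𝔭' hne ι' hι' D₁ hirr hι b hb ΩK Ωp Q hΩK hQ hT

set_option maxHeartbeats 400000 in
/-- **K1♯ ⟺ its depth-`1` slice**: in the sharpened research stub of `membertower` v14 the quantifier `∀ m ≥ 1` and
the congruences modulo `3^m`, `m ≥ 2`, are idle — K1♯ is the statement about the Hida members of the twin's newform
congruent to it MODULO `3` (one equivariant `A_g[3] ≃ (W′[3^∞] ⊗ 𝒪)[3]`) with `ρ̄_g` irreducible.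
[cite: Skinner2016PacificMC, §3.1 (a)(b) (p. 192)] -/
theorem sharp_iff_sharpDepthOne :
    (
    ∀ (W' : WeierstrassCurve ℚ) [W'.IsElliptic] [W'.IsGloballyMinimal] (N' : ℕ) [NeZero N']
      (K : Type) [Field K] [NumberField K] (Dt' : ModularParametrizationData W' N'),
      Mult W' 3 → W'.HasSurjectiveModNGaloisRep 3 → W'.conductorNorm ℤ = N' → IsImaginaryQuadratic K →
      SatisfiesHeegnerHypothesis N' K → Odd (NumberField.discr K) →
      ∀ (κ : ZpExtension K 3), κ.IsAnticyclotomic → ∀ (γ : absoluteGaloisGroup K) [Fact (κ.IsTopGenerator γ)]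
        (𝔭 : HeightOneSpectrum (𝓞 K)), ((3 : ℕ) : 𝓞 K) ∈ 𝔭.asIdeal →
        𝔭.asIdeal.ramificationIdx (𝓞 ℚ) = 1 → 𝔭.asIdeal.inertiaDeg (𝓞 ℚ) = 1 →
        ∀ (𝔭' : HeightOneSpectrum (𝓞 K)), ((3 : ℕ) : 𝓞 K) ∈ 𝔭'.asIdeal → 𝔭' ≠ 𝔭 →
        ∀ (ι' : PadicAlgCl 3 ≃+* ℂ), BranchInducesPrime 3 ι' 𝔭 →
        ∀ (m : ℕ), 1 ≤ m → ∀ (D : Skinner2016.HidaCongruentMember W' 3 m),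
          SkinnerUrban2014.IsResiduallyIrreducible D.Δ → (∀ x : coeffField D.g, ι' (D.ι x) = (x : ℂ)) →
        ∀ (b : padicCoeffIntegers D.ι →+* 𝓞_ℂ_[3]),
          (∀ x, ((b x : 𝓞_ℂ_[3]) : ℂ_[3]) = algebraMap (PadicAlgCl 3) ℂ_[3] (padicCoeffIntegers.toPadicAlgCl D.ι x)) →
        ∀ (ΩK : ℂ) (Ωp : (𝓞_ℂ_[3])ˣ) (Q : PowerSeries 𝓞_ℂ_[3]), ΩK ≠ 0 →
          IsBDPLFunctionWtSigmaInt ι' 𝔭 κ γ D.g (W'.sigmaPlacesFinset 3 K) ΩK ((Ωp : 𝓞_ℂ_[3]) : ℂ_[3]) Q →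
        ∀ [TopologicalSpace (PowerSeries (padicCoeffIntegers D.ι))]
          [ContinuousSMul (PowerSeries (padicCoeffIntegers D.ι))
            (BigRepModule (padicCoeffIntegers D.ι) 3 (Cofree D.Δ.ρ (padicCoeffField D.ι)))],
          Module.IsTorsion (PowerSeries (padicCoeffIntegers D.ι))
              (XBig κ (D.Δ.cofreeRepOver K) 𝔭' (↑(W'.sigmaPlacesFinset 3 K))) →
            ∃ e : ℕ, Ideal.span {(PowerSeries.C ((3 : ℕ) : 𝓞_ℂ_[3]) : PowerSeries 𝓞_ℂ_[3]) ^ e} *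
                (XBig.charIdeal κ (D.Δ.cofreeRepOver K) 𝔭' (↑(W'.sigmaPlacesFinset 3 K))).map (PowerSeries.map b) ≤
              Ideal.span {Q}) ↔
    ∀ (W' : WeierstrassCurve ℚ) [W'.IsElliptic] [W'.IsGloballyMinimal] (N' : ℕ) [NeZero N']
      (K : Type) [Field K] [NumberField K] (Dt' : ModularParametrizationData W' N'),
      Mult W' 3 → W'.HasSurjectiveModNGaloisRep 3 → W'.conductorNorm ℤ = N' → IsImaginaryQuadratic K →
      SatisfiesHeegnerHypothesis N' K → Odd (NumberField.discr K) →
      ∀ (κ : ZpExtension K 3), κ.IsAnticyclotomic → ∀ (γ : absoluteGaloisGroup K) [Fact (κ.IsTopGenerator γ)]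
        (𝔭 : HeightOneSpectrum (𝓞 K)), ((3 : ℕ) : 𝓞 K) ∈ 𝔭.asIdeal →
        𝔭.asIdeal.ramificationIdx (𝓞 ℚ) = 1 → 𝔭.asIdeal.inertiaDeg (𝓞 ℚ) = 1 →
        ∀ (𝔭' : HeightOneSpectrum (𝓞 K)), ((3 : ℕ) : 𝓞 K) ∈ 𝔭'.asIdeal → 𝔭' ≠ 𝔭 →
        ∀ (ι' : PadicAlgCl 3 ≃+* ℂ), BranchInducesPrime 3 ι' 𝔭 →
        ∀ (D : Skinner2016.HidaCongruentMember W' 3 1),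
          SkinnerUrban2014.IsResiduallyIrreducible D.Δ → (∀ x : coeffField D.g, ι' (D.ι x) = (x : ℂ)) →
        ∀ (b : padicCoeffIntegers D.ι →+* 𝓞_ℂ_[3]),
          (∀ x, ((b x : 𝓞_ℂ_[3]) : ℂ_[3]) = algebraMap (PadicAlgCl 3) ℂ_[3] (padicCoeffIntegers.toPadicAlgCl D.ι x)) →
        ∀ (ΩK : ℂ) (Ωp : (𝓞_ℂ_[3])ˣ) (Q : PowerSeries 𝓞_ℂ_[3]), ΩK ≠ 0 →
          IsBDPLFunctionWtSigmaInt ι' 𝔭 κ γ D.g (W'.sigmaPlacesFinset 3 K) ΩK ((Ωp : 𝓞_ℂ_[3]) : ℂ_[3]) Q →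
        ∀ [TopologicalSpace (PowerSeries (padicCoeffIntegers D.ι))]
          [ContinuousSMul (PowerSeries (padicCoeffIntegers D.ι))
            (BigRepModule (padicCoeffIntegers D.ι) 3 (Cofree D.Δ.ρ (padicCoeffField D.ι)))],
          Module.IsTorsion (PowerSeries (padicCoeffIntegers D.ι))
              (XBig κ (D.Δ.cofreeRepOver K) 𝔭' (↑(W'.sigmaPlacesFinset 3 K))) →
            ∃ e : ℕ, Ideal.span {(PowerSeries.C ((3 : ℕ) : 𝓞_ℂ_[3]) : PowerSeries 𝓞_ℂ_[3]) ^ e} *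
                (XBig.charIdeal κ (D.Δ.cofreeRepOver K) 𝔭' (↑(W'.sigmaPlacesFinset 3 K))).map (PowerSeries.map b) ≤
              Ideal.span {Q} :=
  ⟨sharpDepthOne_of_sharp, sharp_of_sharpDepthOne⟩

/-- **K1-at-3 (child stmt-BirchSwinnertonDyer-27934 `TwinMemberRationalInclusionAtThree`, BY NAME) ⟹ K1♯** (discard the
binders `1 ≤ m` and `IsResiduallyIrreducible D.Δ`): the v14 stub is WEAKER than the crux of record, so any closer of
27934 closes the stub (`fun h ↦ sharp_of_twinMemberRationalInclusionAtThree h`). -/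
theorem sharp_of_twinMemberRationalInclusionAtThree (h : TwinMemberRationalInclusionAtThree) :
    ∀ (W' : WeierstrassCurve ℚ) [W'.IsElliptic] [W'.IsGloballyMinimal] (N' : ℕ) [NeZero N']
      (K : Type) [Field K] [NumberField K] (Dt' : ModularParametrizationData W' N'),
      Mult W' 3 → W'.HasSurjectiveModNGaloisRep 3 → W'.conductorNorm ℤ = N' → IsImaginaryQuadratic K →
      SatisfiesHeegnerHypothesis N' K → Odd (NumberField.discr K) →
      ∀ (κ : ZpExtension K 3), κ.IsAnticyclotomic → ∀ (γ : absoluteGaloisGroup K) [Fact (κ.IsTopGenerator γ)]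
        (𝔭 : HeightOneSpectrum (𝓞 K)), ((3 : ℕ) : 𝓞 K) ∈ 𝔭.asIdeal →
        𝔭.asIdeal.ramificationIdx (𝓞 ℚ) = 1 → 𝔭.asIdeal.inertiaDeg (𝓞 ℚ) = 1 →
        ∀ (𝔭' : HeightOneSpectrum (𝓞 K)), ((3 : ℕ) : 𝓞 K) ∈ 𝔭'.asIdeal → 𝔭' ≠ 𝔭 →
        ∀ (ι' : PadicAlgCl 3 ≃+* ℂ), BranchInducesPrime 3 ι' 𝔭 →
        ∀ (m : ℕ), 1 ≤ m → ∀ (D : Skinner2016.HidaCongruentMember W' 3 m),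
          SkinnerUrban2014.IsResiduallyIrreducible D.Δ → (∀ x : coeffField D.g, ι' (D.ι x) = (x : ℂ)) →
        ∀ (b : padicCoeffIntegers D.ι →+* 𝓞_ℂ_[3]),
          (∀ x, ((b x : 𝓞_ℂ_[3]) : ℂ_[3]) = algebraMap (PadicAlgCl 3) ℂ_[3] (padicCoeffIntegers.toPadicAlgCl D.ι x)) →
        ∀ (ΩK : ℂ) (Ωp : (𝓞_ℂ_[3])ˣ) (Q : PowerSeries 𝓞_ℂ_[3]), ΩK ≠ 0 →
          IsBDPLFunctionWtSigmaInt ι' 𝔭 κ γ D.g (W'.sigmaPlacesFinset 3 K) ΩK ((Ωp : 𝓞_ℂ_[3]) : ℂ_[3]) Q →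
        ∀ [TopologicalSpace (PowerSeries (padicCoeffIntegers D.ι))]
          [ContinuousSMul (PowerSeries (padicCoeffIntegers D.ι))
            (BigRepModule (padicCoeffIntegers D.ι) 3 (Cofree D.Δ.ρ (padicCoeffField D.ι)))],
          Module.IsTorsion (PowerSeries (padicCoeffIntegers D.ι))
              (XBig κ (D.Δ.cofreeRepOver K) 𝔭' (↑(W'.sigmaPlacesFinset 3 K))) →
            ∃ e : ℕ, Ideal.span {(PowerSeries.C ((3 : ℕ) : 𝓞_ℂ_[3]) : PowerSeries 𝓞_ℂ_[3]) ^ e} *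
                (XBig.charIdeal κ (D.Δ.cofreeRepOver K) 𝔭' (↑(W'.sigmaPlacesFinset 3 K))).map (PowerSeries.map b) ≤
              Ideal.span {Q} :=
  fun W' _ _ N' _ K _ _ Dt' hmult hsurj hN' hK hH hodd κ hκ γ _ 𝔭 h𝔭 he hf 𝔭' h𝔭' hne ι' hι' m _ D _ ↦
    h W' N' K Dt' hmult hsurj hN' hK hH hodd κ hκ γ 𝔭 h𝔭 he hf 𝔭' h𝔭' hne ι' hι' m D

end Sharp

end Summit.BirchSwinnertonDyer.BirchSwinnertonDyer.Theorems.UniversalToricDescentTwinMemberRationalInclusionAtThreeSharp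

end
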